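/-
Copyright (c) 2026 the pub-hodgecm-mathlib formalisation cell (harness21).  Prover seat hodgecm-mathlib-LH7-p04 (g13), 2026-09-03.  Line LH4 ∕ L2-3 «CM glue» of the dyadic
(D-UNR) road (census `CENSUS-L23-CM.v1.LH10p01g12.md` ROW 5, fence `φ_θ` everywhere): the PARITY-FREE form of ★ `TypeTwoHermitianShiftBindersCM` §2 — the discriminant depth is
any `m ≥ 3` (`|disc χ_{g_w}|_w = exp(−m)`), not `2N + 1`: at a dyadic inert `w` the odd-discriminant law for elliptic `g` fails (LH10-p01 (g13) 06:07Z), and the hermitian shift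
still sends `m ↦ m − 2`, `n ↦ n − 2` (★ P2 `valued_disc_hermitianMoebius_mul`: `|disc χ_{φg}|·|c|² = |disc χ_g|`).
-/
import Literature.NumberTheory.Rogawski1990.TypeFreeHermitianShiftDenominatorsCM  -- ★ file A (this seat, p853704): `isUnit_hermitianShift_denominators_of_disc_lt`; brings ★ γ₃ §1, ★ P3, ★ P2
import Literature.NumberTheory.Automorphic.MatrixGenMoebiusShift                 -- ★ (LH4-p01 (g12)) four-scalar kit: `map_genMoebius`
import HarnessLib

/-!
# The type-(2) hermitian shift at a CM place, parity-free: the binders at `(n − 2, m − 2)` for ANY discriminant depth `m ≥ 3` — no `|2| = 1`, no odd-discriminant law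

Topic `NumberTheory/Rogawski1990`; namespace `Literature.NumberTheory.Rogawski1990`.  THEOREMS ONLY (no definition, no instance, no notation, no named fact, no `sorry`); kernel lane
`--supports stmt-HodgeConjecture-24833`.  Cell `pub/hodgecm-mathlib`, crux H413; line LH4, organ `stub_DyUnramCore` ∕ L2-3, CM-glue road.  ★ `TypeTwoHermitianShiftBindersCM`
`hermitianShifted_binders_of_typeTwo` (this seat, p853697) keeps ★ γ₃'s odd currency `|disc χ_{g_w}|_w = exp(−(2N+1))` — right at every ODD inert place (★
`exists_valued_disc_eq_exp_neg_odd_of_not_exists_isRoot … h2`), but at a DYADIC inert `w` an elliptic `g` may have EVEN discriminant exponent (`L_w(√disc)∕L_w` ramified with even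
conductor exponent).  This file states the same four binders for ANY depth `m ≥ 3`: the shift is exact on valuations (`|disc χ_{φ_θ g}| = q²·|disc χ_g|`, `|χ_{φ_θ g}(φ_θ u)| =
q²·|χ_g(u)|`, ★ P2 §5), so NO parity enters; `m = 2N + 1` recovers p853697's §2.  HONEST LABEL: HC_CM is proved only modulo the cell's 2 remaining named inputs (hLiu418, h413)
until rung 0 closes; this file is an ASSEMBLY over ★ material and asserts nothing printed.

THE MATHEMATICS.  For a type-(2) `γ_H = (g, u)` at a non-split `w ∣ v`, DEEP (`g_w ≡ 1`, `u_w ≡ 1 (mod c_w)`, `|c_w| = exp(−1)`, `σ(c) = c`), `θ + σθ = 1`, `|θ_w| ≤ 1`, with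
`|disc χ_g|_w = exp(−m)`, `m ≥ 3`, `|χ_g(u)|_w = exp(−n)`, `n ≥ 2`, `χ_{g_w}` rootless, and `γ_H′` with `g′ = φ_θ(g)`, `u′ = φ_θ(u)` on matrices: the denominators are units
(★ file A, `exp(−m) < exp(−2)`), `|disc χ_{g′}|_w = exp(−(m−2))`, `|χ_{g′}(u′)|_w = exp(−(n−2))`, `χ_{g′_w}` rootless, `γ_H′` `G`-regular.

## References
* [Rogawski1990] J. D. Rogawski, *Automorphic Representations of Unitary Groups in Three Variables*, Ann. of Math. Stud. 123 (1990), §4.9 Prop. 4.9.1 (b) p. 55; §4.3 p. 42.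
* [Kottwitz1986BaseChangeUnits] R. E. Kottwitz, *Base change for unit elements of Hecke algebras*, Compositio Math. 60 (1986), §2 pp. 244–247.
* [Flicker1998UnitaryFL] Y. Z. Flicker, *Elementary proof of the fundamental lemma for a unitary group*, Canad. J. Math. 50 (1998), §6.
-/

set_option autoImplicit false

noncomputable section

open NumberField IsDedekindDomain Matrix Polynomial
open scoped MatrixGroups WithZero

namespace Literature.NumberTheory.Rogawski1990

open Literature.NumberTheory.Automorphic Literature.NumberTheory.Automorphic.UnitaryGroup Literature.NumberTheory.Automorphic.MoebiusShift
open Literature.NumberTheory.GaloisRepresentations Literature.NumberTheory.NumberFields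

variable (L : Type) [Field L] [NumberField L] [IsCMField L] (v : HeightOneSpectrum (𝓞 ↥(maximalRealSubfield L)))
  (w : PlacesOver L v) (hw : IsCMField.complexConj L • w.1 = w.1)

include hw in
/-- **THE HERMITIAN-SHIFTED BINDERS AT ANY DISCRIMINANT DEPTH `m ≥ 3`**: for a deep `γ_H = (g, u)` at a non-split `w` (`g_w ≡ 1`, `u_w ≡ 1 (mod c_w)`), `θ + σθ = 1`, `|θ_w| ≤ 1`,
`|disc χ_{g_w}|_w = exp(−m)`, `m ≥ 3`, `|χ_g(u)|_w = exp(−n)`, `n ≥ 2`, `χ_{g_w}` rootless, and any `γ_H′` on the carriers with `g′ = φ_θ(g) = (θg + (c−θ))((c−σθ)g + σθ)⁻¹`,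
`u′ = φ_θ(u)` as matrices: `|disc χ_{g′}|_w = exp(−(m−2))`, `|χ_{g′}(u′)|_w = exp(−(n−2))`, `χ_{g′_w}` has no root in `L_w`, and `γ_H′` is `G`-regular — PARITY-FREE form of ★
`hermitianShifted_binders_of_typeTwo` (`m = 2N+1`), valid at dyadic `w` (★ P2 `valued_disc_hermitianMoebius_mul`, ★ P3 `valued_eval_charpoly_hermitianMoebius_of_exp`,
`not_exists_isRoot_charpoly_genMoebius`; denominators by ★ file A `isUnit_hermitianShift_denominators_of_disc_lt`; NO `|2|_w = 1`). [cite: Flicker1998UnitaryFL, §6]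
[cite: Kottwitz1986BaseChangeUnits, §2 pp. 244–247] [cite: Rogawski1990, §4.9 Prop. 4.9.1 (b) p. 55; §4.3 p. 42] -/
theorem hermitianShifted_binders_of_disc_exp
    (γH γH' : (cmDatum L 2 (Matrix.of fun i j : Fin 2 => if i.val + j.val + 1 = 2 then (1 : L) else 0)).Local v ×
      (cmDatum L 1 (Matrix.of fun i j : Fin 1 => if i.val + j.val + 1 = 1 then (1 : L) else 0)).Local v)
    {c : LocalRing L v} (hσc : conjLocal L (IsCMField.complexConj L) v c = c) (hc : Valued.v (c w) = WithZero.exp (-1 : ℤ))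
    (θ : LocalRing L v) (hθ : θ + conjLocal L (IsCMField.complexConj L) v θ = 1) (hθv : Valued.v (θ w) ≤ 1)
    (h1 : ((γH'.1.val : GL (Fin 2) (LocalRing L v)).val : Matrix (Fin 2) (Fin 2) (LocalRing L v)) =
      (θ • ((γH.1.val : GL (Fin 2) (LocalRing L v)).val : Matrix (Fin 2) (Fin 2) (LocalRing L v)) + (c - θ) • 1) *
        ((c - conjLocal L (IsCMField.complexConj L) v θ) • ((γH.1.val : GL (Fin 2) (LocalRing L v)).val : Matrix (Fin 2) (Fin 2) (LocalRing L v)) +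
          conjLocal L (IsCMField.complexConj L) v θ • 1)⁻¹)
    (hu' : finGammaTwo L v γH' = (θ * finGammaTwo L v γH + (c - θ)) *
      Ring.inverse ((c - conjLocal L (IsCMField.complexConj L) v θ) * finGammaTwo L v γH + conjLocal L (IsCMField.complexConj L) v θ))
    (hg1 : ∀ i j, Valued.v ((((γH.1.val : GL (Fin 2) (LocalRing L v)).val.map (Pi.evalRingHom (fun w' : PlacesOver L v => w'.1.adicCompletion L) w)) - 1) i j) ≤ Valued.v (c w))
    (hu1 : Valued.v (finGammaTwo L v γH w - 1) ≤ Valued.v (c w))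
    (hirr : ¬ ∃ x : w.1.adicCompletion L, (((γH.1.val : GL (Fin 2) (LocalRing L v)).val.map
        (Pi.evalRingHom (fun w' : PlacesOver L v => w'.1.adicCompletion L) w)).charpoly).IsRoot x)
    {n m : ℕ} (hn2 : 2 ≤ n) (hm3 : 3 ≤ m)
    (hn : Valued.v (((finCharpolyTwo L v γH).eval (finGammaTwo L v γH)) w) = WithZero.exp (-(n : ℤ)))
    (hm : Valued.v (((γH.1.val : GL (Fin 2) (LocalRing L v)).val.map
        (Pi.evalRingHom (fun w' : PlacesOver L v => w'.1.adicCompletion L) w)).trace ^ 2 -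
      4 * ((γH.1.val : GL (Fin 2) (LocalRing L v)).val.map
        (Pi.evalRingHom (fun w' : PlacesOver L v => w'.1.adicCompletion L) w)).det) = WithZero.exp (-(m : ℤ))) :
    Valued.v (((γH'.1.val : GL (Fin 2) (LocalRing L v)).val.map
        (Pi.evalRingHom (fun w' : PlacesOver L v => w'.1.adicCompletion L) w)).trace ^ 2 -
      4 * ((γH'.1.val : GL (Fin 2) (LocalRing L v)).val.map
        (Pi.evalRingHom (fun w' : PlacesOver L v => w'.1.adicCompletion L) w)).det) = WithZero.exp (-((m - 2 : ℕ) : ℤ)) ∧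
    Valued.v (((finCharpolyTwo L v γH').eval (finGammaTwo L v γH')) w) = WithZero.exp (-((n - 2 : ℕ) : ℤ)) ∧
    (¬ ∃ x : w.1.adicCompletion L, (((γH'.1.val : GL (Fin 2) (LocalRing L v)).val.map
        (Pi.evalRingHom (fun w' : PlacesOver L v => w'.1.adicCompletion L) w)).charpoly).IsRoot x) ∧
    IsLocalGRegular L v γH' := by
  have hv : Subsingleton (PlacesOver L v) := PlacesOver.subsingleton_of_smul_eq (IsCMField.complexConj L) (IsCMField.complexConj_ne_one L) w hw
  -- the denominators are units: `exp(−m) < exp(−2)` (★ file A, type-free)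
  have hdisc : Valued.v (((γH.1.val : GL (Fin 2) (LocalRing L v)).val.map
        (Pi.evalRingHom (fun w' : PlacesOver L v => w'.1.adicCompletion L) w)).trace ^ 2 -
      4 * ((γH.1.val : GL (Fin 2) (LocalRing L v)).val.map
        (Pi.evalRingHom (fun w' : PlacesOver L v => w'.1.adicCompletion L) w)).det) < WithZero.exp (-2 : ℤ) := by
    rw [hm, WithZero.exp_lt_exp]; omega
  obtain ⟨hw2m, -, hw1m, -, hU2m, -, hU1m, -, -, -, -⟩ := isUnit_hermitianShift_denominators_of_disc_lt L v w hw γH hσc hc θ hθ hθv hg1 hu1 hdisc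
  set evw : LocalRing L v →+* w.1.adicCompletion L := Pi.evalRingHom (fun w' : PlacesOver L v => w'.1.adicCompletion L) w with hevw
  set σw := galAdicCompletionMap (L := L) (IsCMField.complexConj L) hw with hσw
  set gw : Matrix (Fin 2) (Fin 2) (w.1.adicCompletion L) := ((γH.1.val : GL (Fin 2) (LocalRing L v)).val.map evw) with hgw
  set uw : w.1.adicCompletion L := finGammaTwo L v γH w with huw
  set cw : w.1.adicCompletion L := c w with hcw
  obtain ⟨hc0, hc1, -, -, -, -⟩ := shift_parameter_facts hc
  -- characteristic zero: `2 ≠ 0` in `L_w` (no valuation hypothesis on `2` is used anywhere)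
  haveI : CharZero (w.1.adicCompletion L) := charZero_of_injective_algebraMap (algebraMap L (w.1.adicCompletion L)).injective
  haveI : NeZero (2 : w.1.adicCompletion L) := ⟨two_ne_zero⟩
  -- the hermitian parameter at `w`
  have hSθ : evw (conjLocal L (IsCMField.complexConj L) v θ) = σw (θ w) :=
    conjLocal_apply_eq_of_smul_eq (IsCMField.complexConj L) (IsCMField.complexConj_ne_one L) v w hw θ
  have hθw : θ w + σw (θ w) = 1 := by
    have h := congrFun hθ w
    rw [Pi.add_apply, Pi.one_apply] at h
    rw [← hSθ]; exact h
  -- `g′_w = φ_θ(g_w)` and `u′_w = φ_θ(u_w)`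
  have hg'w : ((γH'.1.val : GL (Fin 2) (LocalRing L v)).val.map evw) =
      (θ w • gw + (cw - θ w) • (1 : Matrix (Fin 2) (Fin 2) (w.1.adicCompletion L))) *
        ((cw - σw (θ w)) • gw + σw (θ w) • (1 : Matrix (Fin 2) (Fin 2) (w.1.adicCompletion L)))⁻¹ := by
    rw [h1, map_genMoebius evw _ _ _ _ _ hU2m, map_sub, map_sub, hSθ]
    rfl
  have hD2w : Valued.v (((cw - σw (θ w)) • gw + σw (θ w) • (1 : Matrix (Fin 2) (Fin 2) (w.1.adicCompletion L))).det) = WithZero.exp (-2 : ℤ) := by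
    have e1 : (((c - conjLocal L (IsCMField.complexConj L) v θ) • ((γH.1.val : GL (Fin 2) (LocalRing L v)).val : Matrix (Fin 2) (Fin 2) (LocalRing L v)) +
        conjLocal L (IsCMField.complexConj L) v θ • (1 : Matrix (Fin 2) (Fin 2) (LocalRing L v))).det) w =
        evw (((c - conjLocal L (IsCMField.complexConj L) v θ) • ((γH.1.val : GL (Fin 2) (LocalRing L v)).val : Matrix (Fin 2) (Fin 2) (LocalRing L v)) +
        conjLocal L (IsCMField.complexConj L) v θ • (1 : Matrix (Fin 2) (Fin 2) (LocalRing L v))).det) := rfl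
    have e : (((c - conjLocal L (IsCMField.complexConj L) v θ) • ((γH.1.val : GL (Fin 2) (LocalRing L v)).val : Matrix (Fin 2) (Fin 2) (LocalRing L v)) +
        conjLocal L (IsCMField.complexConj L) v θ • (1 : Matrix (Fin 2) (Fin 2) (LocalRing L v))).det) w =
        (((cw - σw (θ w)) • gw + σw (θ w) • (1 : Matrix (Fin 2) (Fin 2) (w.1.adicCompletion L))).det) := by
      rw [e1, RingHom.map_det, RingHom.mapMatrix_apply, map_smul_add_smul_one, map_sub, hSθ]
      rfl
    rw [← e]; exact hw2m
  have hscw : ((c - conjLocal L (IsCMField.complexConj L) v θ) * finGammaTwo L v γH + conjLocal L (IsCMField.complexConj L) v θ) w = (cw - σw (θ w)) * uw + σw (θ w) := by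
    show evw ((c - conjLocal L (IsCMField.complexConj L) v θ) * finGammaTwo L v γH + conjLocal L (IsCMField.complexConj L) v θ) = _
    rw [map_add, map_mul, map_sub, hSθ]
    rfl
  have hw1m' : Valued.v ((cw - σw (θ w)) * uw + σw (θ w)) = WithZero.exp (-1 : ℤ) := by rw [← hscw]; exact hw1m
  have huw' : finGammaTwo L v γH' w = (θ w * uw + (cw - θ w)) / ((cw - σw (θ w)) * uw + σw (θ w)) := by
    have hmul : finGammaTwo L v γH' * ((c - conjLocal L (IsCMField.complexConj L) v θ) * finGammaTwo L v γH + conjLocal L (IsCMField.complexConj L) v θ) =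
        θ * finGammaTwo L v γH + (c - θ) := by
      rw [hu', mul_assoc, Ring.inverse_mul_cancel _ hU1m, mul_one]
    have hmw := congrFun hmul w
    rw [Pi.mul_apply, hscw] at hmw
    have hne : (cw - σw (θ w)) * uw + σw (θ w) ≠ 0 := fun h => by
      rw [h, map_zero] at hw1m'; exact WithZero.zero_ne_coe hw1m'
    rw [eq_div_iff hne, hmw]
    rfl
  -- (1) the discriminant: `|disc χ_{φg}|·|c|² = |disc χ_g|` (★ P2, parity-free)
  have e2 : Valued.v cw ^ 2 = WithZero.exp (-2 : ℤ) := by rw [hc, ← WithZero.exp_nsmul]; norm_num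
  have hN' : Valued.v (((θ w • gw + (cw - θ w) • (1 : Matrix (Fin 2) (Fin 2) (w.1.adicCompletion L))) *
        ((cw - σw (θ w)) • gw + σw (θ w) • (1 : Matrix (Fin 2) (Fin 2) (w.1.adicCompletion L)))⁻¹).trace ^ 2 -
      4 * ((θ w • gw + (cw - θ w) • (1 : Matrix (Fin 2) (Fin 2) (w.1.adicCompletion L))) *
        ((cw - σw (θ w)) • gw + σw (θ w) • (1 : Matrix (Fin 2) (Fin 2) (w.1.adicCompletion L)))⁻¹).det) = WithZero.exp (-((m - 2 : ℕ) : ℤ)) := by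
    have key := valued_disc_hermitianMoebius_mul σw hθw hc0 hc1 gw (by rw [hD2w, e2])
    rw [e2, hm] at key
    rw [← eq_mul_inv_iff_mul_eq₀ (WithZero.exp_ne_zero (a := (-2 : ℤ))), ← WithZero.exp_neg, ← WithZero.exp_add] at key
    rw [key, WithZero.exp_inj]
    omega
  rw [← hg'w] at hN'
  -- (2) the value `χ_{g′}(u′)`
  have hev : ∀ (γ : (cmDatum L 2 (Matrix.of fun i j : Fin 2 => if i.val + j.val + 1 = 2 then (1 : L) else 0)).Local v ×
      (cmDatum L 1 (Matrix.of fun i j : Fin 1 => if i.val + j.val + 1 = 1 then (1 : L) else 0)).Local v),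
      ((finCharpolyTwo L v γ).eval (finGammaTwo L v γ)) w = (((γ.1.val : GL (Fin 2) (LocalRing L v)).val.map evw).charpoly).eval (finGammaTwo L v γ w) := fun γ => by
    have e : ((finCharpolyTwo L v γ).eval (finGammaTwo L v γ)) w = evw ((finCharpolyTwo L v γ).eval (finGammaTwo L v γ)) := rfl
    rw [e, ← Polynomial.eval₂_at_apply, ← Polynomial.eval_map, finCharpolyTwo, ← Matrix.charpoly_map]
    rfl
  have hnw : Valued.v (gw.charpoly.eval uw) = WithZero.exp (-(n : ℤ)) := by rw [hgw, huw, ← hev]; exact hn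
  have hn' := valued_eval_charpoly_hermitianMoebius_of_exp σw hθw hc gw uw hD2w hw1m' hn2 hnw
  rw [← hg'w, ← huw'] at hn'
  rw [← hev] at hn'
  -- (3) no root: the key scalar `θσθ − (c−θ)(c−σθ) = c(1−c)` is non-zero
  have hD0 : ((cw - σw (θ w)) • gw + σw (θ w) • (1 : Matrix (Fin 2) (Fin 2) (w.1.adicCompletion L))).det ≠ 0 := fun h => by
    rw [h, map_zero] at hD2w; exact WithZero.zero_ne_coe hD2w
  have hc1' : (1 : w.1.adicCompletion L) - cw ≠ 0 := fun h => by
    rw [sub_eq_zero] at h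
    rw [← h, map_one] at hc1
    exact lt_irrefl _ hc1
  have hΔ : θ w * σw (θ w) - (cw - θ w) * (cw - σw (θ w)) ≠ 0 := by
    rw [hermitianPair_key_scalar σw hθw cw]
    exact mul_ne_zero hc0 hc1'
  have hirr' := not_exists_isRoot_charpoly_genMoebius gw (θ w) (cw - θ w) (σw (θ w)) (cw - σw (θ w)) hD0 hΔ hirr
  rw [← hg'w] at hirr'
  -- (4) `G`-regularity: separability at `w`, lifted to `E_v` (verbatim ★ γ₃)
  have hdisc' : ((γH'.1.val : GL (Fin 2) (LocalRing L v)).val.map evw).trace ^ 2 - 4 * ((γH'.1.val : GL (Fin 2) (LocalRing L v)).val.map evw).det ≠ 0 := fun h => by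
    rw [h, map_zero] at hN'; exact WithZero.zero_ne_coe hN'
  have hval' : (((γH'.1.val : GL (Fin 2) (LocalRing L v)).val.map evw).charpoly).eval (finGammaTwo L v γH' w) ≠ 0 := fun h => by
    rw [hev, h, map_zero] at hn'; exact WithZero.zero_ne_coe hn'
  have hsepw := separable_charpoly_mul_X_sub_C _ _ hdisc' hval'
  have hreg' : IsLocalGRegular L v γH' := by
    have hgoal : (((γH'.1.val : GL (Fin 2) (LocalRing L v)).val : Matrix (Fin 2) (Fin 2) (LocalRing L v)).charpoly *
        ((γH'.2.val : GL (Fin 1) (LocalRing L v)).val : Matrix (Fin 1) (Fin 1) (LocalRing L v)).charpoly).Separable := by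
      refine separable_of_map_evalRingHom L v w hv _ ?_
      rw [Polynomial.map_mul, ← Matrix.charpoly_map, ← Matrix.charpoly_map]
      have hUc : (((γH'.2.val : GL (Fin 1) (LocalRing L v)).val : Matrix (Fin 1) (Fin 1) (LocalRing L v)).map evw).charpoly = X - C (finGammaTwo L v γH' w) := by
        rw [Matrix.charpoly, Matrix.det_fin_one, Matrix.charmatrix_apply_eq, Matrix.map_apply]
        rfl
      rw [hUc]
      exact hsepw
    simp only [IsLocalGRegular, IsGRegular, IsRegularElt, coe_endoEmb, coe_endoGL, Matrix.charpoly_reindex, Matrix.charpoly_fromBlocks_zero₁₂]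
    exact hgoal
  exact ⟨hN', hn', hirr', hreg'⟩

end Literature.NumberTheory.Rogawski1990

end
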